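import Summits.BirchSwinnertonDyer.BirchSwinnertonDyer.Theorems.InertBadSignedBranchesInertBadAtThreeOffIstarZeroQuarticFamilyIff
import HarnessLib

set_option linter.dupNamespace false -- `Summit.BirchSwinnertonDyer.BirchSwinnertonDyer.Theorems.…` (summit = sub, D-0017)
set_option autoImplicit false

/-!
# Crux `InertBadAtThree` (stmt-BirchSwinnertonDyer-19225), line of record `rubin_e1_inert_three`, registered stub
# `stub_neronIntegralThreeQuartic` — STUB-PLAN piece **P1a `stub_quarticModel`**: the quartic cell is the family
# `y² = x³ − Dx`, `3 ∣ D`, `D` fourth-power-free (width seat `bsd-wall-cm-bed-w2` g8; theorems only)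

HONEST FRAMING (cell `pub/bsd-wall`, D-0154 row 12): Birch–Swinnerton-Dyer is NOT proved by any of this; the crux
`InertBadAtThree` is open; this file proves ONE bookkeeping piece (P1a, size M) of the stub plan
`Cruxes/InertBadAtThree/STUB-PLAN-neronIntegralThreeQuartic-bsd-idea-18-g8.md` §2 for the registered stub of the line of
record (lead `bsd-line-ibd-p1` g6), with the plan's signature VERBATIM:

* `stub_quarticModel`: a globally minimal `V/ℚ` with `j(V) = 1728` and bad reduction at `3` is `V = e • ⟨0, 0, 0, −D, 0⟩` for a
  variable change `e` over `ℚ` and an integer `D ≠ 0`, `3 ∣ D`, with NO prime fourth power dividing `D`.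

Proof (all inputs are tree theorems): the normal form `C • V = ⟨0,0,0, 2^r A₀, 0⟩`, `r < 4`, `A₀` odd, of
`Literature.NumberTheory.EllipticCurves.exists_variableChange_eq_of_j_eq_1728` (Silverman, *AEC* X.5.4 (iii)); removal of prime
fourth powers from `A = 2^r A₀` by the scalings `(p; 0, 0, 0)` (`X12.smul_quartic_scale`: `a₄ ↦ a₄/p⁴`), by strong induction on `|A|`
(`exists_eq_pow_four_mul_fourthPowerFree`); `D := −A`; and `3 ∣ D` because otherwise `y² = x³ + Ax` has unit discriminant valuation
at the place over `3` (`InertBadOffQuarticFamilyIff.hasGoodReductionAt_of_eq_quartic_unit`), good reduction is invariant under `ℚ`-isomorphism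
(`hasGoodReductionAt_smul_iff_holds`, *AEC* VII.5.1 (a)) and equals the prime-indexed predicate (`X12.good_iff_hasGoodReductionAt`).

References (locators only): [SilvermanAEC2009] X.5.4 (iii), VII.1 Remark 1.1, VII.5 Prop. 5.1 (a).
-/

noncomputable section

open scoped Classical NumberField

open WeierstrassCurve NumberField IsDedekindDomain Rat.HeightOneSpectrum
open Literature.NumberTheory.EllipticCurves
open Literature.NumberTheory.GaloisRepresentations
open Literature.NumberTheory.DiophantineGeometry
open Literature.NumberTheory.EllipticCurves.Rank1Residual
open Summit.BirchSwinnertonDyer.Rank1Residual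
open Summit.BirchSwinnertonDyer.Rank1Residual.X12
open Summit.BirchSwinnertonDyer.BirchSwinnertonDyer.Theorems.InertBadOffQuarticFamilyIff

namespace Summit.BirchSwinnertonDyer.BirchSwinnertonDyer.Theorems.InertBadSignedBranchesInertBadAtThreeQuarticModelFourthPowerFree

/-! ## Fourth-power-free parts of integers -/

/-- Every nonzero integer is `A = m⁴ · B` with `m ≥ 1` and `B` FOURTH-POWER-FREE (no prime `p` with `p⁴ ∣ B`); strong
induction on `|A|`, peeling off one prime fourth power at a time. [folklore] -/
theorem exists_eq_pow_four_mul_fourthPowerFree (A : ℤ) (hA : A ≠ 0) :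
    ∃ (m : ℕ) (B : ℤ), 0 < m ∧ A = (m : ℤ) ^ 4 * B ∧ ∀ p : ℕ, p.Prime → ¬ ((p : ℤ) ^ 4 ∣ B) := by
  induction h : A.natAbs using Nat.strong_induction_on generalizing A with
  | _ n ih =>
    by_cases hex : ∃ p : ℕ, p.Prime ∧ (p : ℤ) ^ 4 ∣ A
    · obtain ⟨p, hp, ⟨A', hA'⟩⟩ := hex
      have hA'0 : A' ≠ 0 := by rintro rfl; rw [mul_zero] at hA'; exact hA hA'
      have hlt : A'.natAbs < n := by
        rw [← h, hA', Int.natAbs_mul, Int.natAbs_pow, Int.natAbs_natCast]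
        have h2 : 2 ≤ p := hp.two_le
        have hpos : 0 < A'.natAbs := Int.natAbs_pos.mpr hA'0
        have h16 : 16 ≤ p ^ 4 := by
          calc 16 = 2 ^ 4 := by norm_num
            _ ≤ p ^ 4 := Nat.pow_le_pow_left h2 4
        nlinarith
      obtain ⟨m', B, hm', hAB, hB⟩ := ih _ hlt A' hA'0 rfl
      refine ⟨p * m', B, Nat.mul_pos hp.pos hm', ?_, hB⟩
      rw [hA', hAB]; push_cast; ring
    · simp only [not_exists, not_and] at hex
      exact ⟨1, A, Nat.one_pos, by simp, hex⟩

/-! ## P1a `stub_quarticModel` -/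

/-- **STUB-PLAN P1a `stub_quarticModel` (M), signature verbatim: the quartic cell is the family `y² = x³ − Dx`, `3 ∣ D`,
`D` fourth-power-free.** A globally minimal `V/ℚ` with `j = 1728` bad at `3` is `ℚ`-isomorphic to `⟨0,0,0,−D,0⟩` for a
fourth-power-free `D ∈ ℤ ∖ 0` with `3 ∣ D`. From *AEC* X.5.4 (iii) (`exists_variableChange_eq_of_j_eq_1728`: `C • V = ⟨0,0,0,A,0⟩`,
`A = 2^r A₀ ∈ ℤ ∖ 0`), the scalings `(m; 0,0,0)` (`smul_quartic_scale`, `A ↦ A/m⁴`) to the fourth-power-free part, and good reduction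
of `y² = x³ + Ax` at `3 ∤ A` transported along `ℚ`-isomorphisms (*AEC* VII.5.1 (a)). [folklore] -/
theorem stub_quarticModel (V : WeierstrassCurve ℚ) [V.IsElliptic] [V.IsGloballyMinimal]
    (hj : V.j = 1728) (hbad : ¬ V.HasGoodReductionAtPrime 3) :
    ∃ (D : ℤ) (e : WeierstrassCurve.VariableChange ℚ), D ≠ 0 ∧ (3 : ℤ) ∣ D ∧
      (∀ p : ℕ, p.Prime → ¬ ((p : ℤ) ^ 4 ∣ D)) ∧
      V = e • (⟨0, 0, 0, -(D : ℚ), 0⟩ : WeierstrassCurve ℚ) := by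
  -- the normal form `C • V = (y² = x³ + A x)`, `A = 2^r A₀ ∈ ℤ ∖ {0}`
  obtain ⟨r, A₀, C, -, hodd, hC⟩ := exists_variableChange_eq_of_j_eq_1728 V hj
  have hA00 : A₀ ≠ 0 := by rintro rfl; exact absurd hodd (by decide)
  set A : ℤ := 2 ^ r * A₀ with hA
  have hA0 : A ≠ 0 := mul_ne_zero (pow_ne_zero _ two_ne_zero) hA00
  have hC' : C • V = ⟨0, 0, 0, (A : ℚ), 0⟩ := by rw [hC, hA]; push_cast; rfl
  -- the fourth-power-free part `A = m⁴ B`, rescale by `u = m`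
  obtain ⟨m, B, hm, hAB, hB⟩ := exists_eq_pow_four_mul_fourthPowerFree A hA0
  have hB0 : B ≠ 0 := by rintro rfl; rw [mul_zero] at hAB; exact hA0 hAB
  have hm0 : (m : ℚ) ≠ 0 := by exact_mod_cast hm.ne'
  set u : ℚˣ := Units.mk0 (m : ℚ) hm0 with hu
  have hu4 : ((u : ℚ))⁻¹ ^ 4 * ((m : ℚ)) ^ 4 = 1 := by
    rw [← mul_pow, hu, Units.val_mk0, inv_mul_cancel₀ hm0, one_pow]
  set e : VariableChange ℚ := ⟨u, 0, 0, 0⟩ * C with he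
  have hD : e • V = ⟨0, 0, 0, (B : ℚ), 0⟩ := by
    rw [he, mul_smul, hC', X12.smul_quartic_scale, hAB]
    push_cast
    rw [← mul_assoc, hu4, one_mul]
  haveI : (e • V).IsElliptic := inferInstance
  -- `3 ∣ B`: otherwise good reduction at `3`
  have h3 : (3 : ℤ) ∣ B := by
    by_contra h3B
    obtain ⟨v, hv⟩ := InertBadOffLowerHalf.exists_place_three
    have hv2 : natGenerator v ≠ 2 := by rw [hv]; decide
    have hval : v.valuation ℚ ((B : ℤ) : ℚ) = 1 :=
      Rat.valuation_intCast_eq_one v (by rw [hv]; exact_mod_cast h3B)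
    have hgood := hasGoodReductionAt_of_eq_quartic_unit (e • V) v hv2 hD hval
    exact hbad ((good_iff_hasGoodReductionAt V 3 v hv).mpr ((hasGoodReductionAt_smul_iff_holds v V e).mp hgood))
  refine ⟨-B, e⁻¹, neg_ne_zero.mpr hB0, (dvd_neg).mpr h3, fun p hp h4 ↦ hB p hp ((dvd_neg).mp h4), ?_⟩
  have hcast : (⟨0, 0, 0, -((-B : ℤ) : ℚ), 0⟩ : WeierstrassCurve ℚ) = ⟨0, 0, 0, (B : ℚ), 0⟩ := by
    push_cast; rw [neg_neg]
  rw [hcast, ← hD, inv_smul_smul]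

end Summit.BirchSwinnertonDyer.BirchSwinnertonDyer.Theorems.InertBadSignedBranchesInertBadAtThreeQuarticModelFourthPowerFree

end
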